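import Literature.Analysis.FluidPDE.CLVelocityEstimates
import HarnessLib

/-!
# Cheskidov–Luo convex integration: pointwise and slice bounds for the new stress (CL22 §5.3)

Analysis/FluidPDE support file (all results proved) for the proof of Prop. 4.1 of A. Cheskidov,
X. Luo, *Sharp nonuniqueness for the Navier–Stokes equations*, Invent. Math. 229 (2022) =
arXiv:2009.06596, §5.3 (Lemmas 5.6–5.8; numbering of the held arXiv copy), for the explicit
fields `S₁`, `ff` of `CLStressAlgebra` (data `D : CL22.Datum d`) entering the new Reynolds stress
`R₁ = S̊₁ + (u ⊗ w + w ⊗ u)˚ - (∇w + ∇wᵀ) + ℛ ff` (`NSRPerturbation`), with the constants `A`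
(`D.DataBounds A`, "`C_u`") and `C` (`D.BlockConsts C`, "`≲`") of `CLDataBounds`, `a = (d-1)/2`:

* the symmetric tensor `S₁ = (w ⊗ w - w^{(p)} ⊗ w^{(p)}) + E^A + E^B + E^C` (`S₁_eq`), where
  `E^A = ∑_x S(c^A_x, P_x)`, `E^B = ∑_x∑ⱼ S(c^B_{x,j}, Φ^B_{x,j})`, `E^C = ∑_x S(c^C_x, Φ^C_x)` are the
  expansion tensors of the three atoms; pointwise `‖S(c, Φ)‖ ≤ 2‖c‖∑ₗ|∂ₗΦ|`, `‖c^A_x‖ ≤ 3A|G_x'|`,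
  `‖c^B_{x,j}‖ ≤ 2A|G_x'|`, `‖c^C_x‖ ≤ 3AG_x²`, whence the SLICE BOUNDS (`1 ≤ r ≤ 2`)
  `‖E^A(t)‖_{L^r} ≤ ∑_x 6AdCσ⁻¹μ^{a-1-(d-1)/r}|G_x'(t)|` (the size `σ⁻¹‖∂ₜa‖‖Ω‖_r` of the term `L₂`
  of Lemma 5.6, here without Calderón–Zygmund), `‖E^B(t)‖_{L^r} ≤ ∑_x 4Ad²Cσ⁻²μ^{a-2-(d-1)/r}|G_x'(t)|`,
  `‖E^C(t)‖_{L^r} ≤ ∑_x 6AdCσ⁻¹μ^a G_x(t)²` (the size `σ⁻¹‖∇a²‖‖T_k‖` of `R_{osc,x}`, Lemma 5.8), and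
  `‖(w ⊗ w - w^{(p)} ⊗ w^{(p)})(t,y)‖ ≤ 2W(t)V(t) + V(t)²` with the sup profiles `W`, `V` of
  `w^{(p)}` and `w^{(c)} + w^{(t)}` (`CLVelocityEstimates`; the size of `R_cor`, Lemma 5.7);
* the remainder `ff = F¹ + F² - F³ - F⁴ᴮ - F⁴ᶜ` (`ff_eq`) with its `L²` slice bounds:
  `‖F¹(t)‖₂ ≤ ∑_x 3AC|G_x|` (`G_x∂ₜã_xψ_x`), `‖F²(t)‖₂ ≤ ∑_x 6AdCσ⁻¹μ^{-1}|G_x|` (`G_xΩ̃_x[∂ₜ∇ã_x]`),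
  `‖F³(t,y)‖ ≤ Nν⁻¹(A + 2A²)` (`H_xθ²∂ₜZ_x + H_x(θ²)'Z_x`), and for the expansion remainders
  (`‖r(c,Φ)‖ ≤ (2d+1) (sup‖∂c‖) ∑ₗ|∂ₗΦ|`): `‖F⁴ᴮ(t)‖₂ ≤ ∑_x 2(2d+1)Ad²Cσ⁻²μ⁻²|G_x'|`,
  `‖F⁴ᶜ(t)‖₂ ≤ ∑_x 3(2d+1)AdCσ⁻¹μ^a G_x²`.

The assembly of these into `‖R₁‖_{L¹(0,T;L^r)}` (with `ℛ` bounded on `L²`, Thm. 7.3 for `p = 2`)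
is the sibling file `CLStressEstimates`.

## References

* A. Cheskidov, X. Luo, arXiv:2009.06596, §4.5 Lemmas 4.5–4.6, §5.3 Lemmas 5.6–5.8.
  [`CheskidovLuo2022`]
-/

noncomputable section

open Set Filter Topology Function MeasureTheory Finset
open scoped ContDiff ENNReal

namespace Literature.Analysis.FluidPDE

namespace CL22

open FunctionSpaces NashGeometric Mikado Intermittent

variable {d : Type*} [Fintype d] [DecidableEq d]

omit [DecidableEq d] in
/-- `‖V‖ ≤ ∑ᵢ |Vᵢ|` on `ℝ^d` (private copy; cf. `NSRPerturbation`). [folklore] -/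
private theorem norm_le_sum_abs'' (V : EuclideanSpace ℝ d) : ‖V‖ ≤ ∑ i, |V i| := by
  rw [EuclideanSpace.norm_eq]
  have h0 : 0 ≤ ∑ i, |V i| := Finset.sum_nonneg fun _ _ => abs_nonneg _
  rw [Real.sqrt_le_left h0]
  calc ∑ i, ‖V i‖ ^ 2 = ∑ i, |V i| ^ 2 := by simp [Real.norm_eq_abs]
    _ ≤ (∑ i, |V i|) ^ 2 := Finset.sum_sq_le_sq_sum_of_nonneg fun i _ => abs_nonneg _

/-! ## Pointwise bounds for the expansion objects -/

section Expansion

/-- **`‖S(c,Φ)(y) eⱼ‖ ≤ 2‖c(y)‖ ∑ₗ|∂ₗΦ(y)|`** for the expansion tensor `S_{ij} = cᵢ∂ⱼΦ + cⱼ∂ᵢΦ`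
(column `j`). [folklore] -/
theorem norm_expansionTensor_apply_le {c : UnitAddTorus d → EuclideanSpace ℝ d} {Φ : UnitAddTorus d → ℝ}
    (hΦ : Torus.IsContDiff 1 Φ) (y : UnitAddTorus d) (j : d) :
    ‖Torus.expansionTensor c Φ y j‖ ≤ 2 * ‖c y‖ * ∑ l, |Torus.partialDeriv l Φ y| := by
  have hS0 : 0 ≤ ∑ l, |Torus.partialDeriv l Φ y| := Finset.sum_nonneg fun _ _ => abs_nonneg _
  have h1 : |Torus.partialDeriv j Φ y| ≤ ∑ l, |Torus.partialDeriv l Φ y| :=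
    Finset.single_le_sum (f := fun l => |Torus.partialDeriv l Φ y|) (fun _ _ => abs_nonneg _) (Finset.mem_univ j)
  have h2 : ‖Torus.gradient Φ y‖ ≤ ∑ l, |Torus.partialDeriv l Φ y| :=
    (norm_le_sum_abs'' _).trans (le_of_eq (Finset.sum_congr rfl fun l _ => by rw [Torus.gradient_apply hΦ]))
  have h3 : |c y j| ≤ ‖c y‖ := Torus.abs_apply_le_norm _ j
  unfold Torus.expansionTensor
  calc ‖Torus.partialDeriv j Φ y • c y + c y j • Torus.gradient Φ y‖
      ≤ |Torus.partialDeriv j Φ y| * ‖c y‖ + |c y j| * ‖Torus.gradient Φ y‖ := by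
        refine (norm_add_le _ _).trans (le_of_eq ?_); rw [norm_smul, norm_smul, Real.norm_eq_abs, Real.norm_eq_abs]
    _ ≤ (∑ l, |Torus.partialDeriv l Φ y|) * ‖c y‖ + ‖c y‖ * ∑ l, |Torus.partialDeriv l Φ y| := by gcongr
    _ = 2 * ‖c y‖ * ∑ l, |Torus.partialDeriv l Φ y| := by ring

/-- **`‖r(c,Φ)(y)‖ ≤ (2d+1) K ∑ₗ|∂ₗΦ(y)|`** for the expansion remainder
`r = ∑ⱼ ∂ⱼΦ ∂ⱼc + (div c)∇Φ - ∑ⱼ (∇Φ)ⱼ ∇cⱼ`, if `‖∂ₗc(y)‖ ≤ K` for all `l`. [folklore] -/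
theorem norm_expansionRemainder_le {c : UnitAddTorus d → EuclideanSpace ℝ d} {Φ : UnitAddTorus d → ℝ}
    (hc : Torus.IsSmooth c) (hΦ : Torus.IsContDiff 1 Φ) (y : UnitAddTorus d) {K : ℝ} (hK0 : 0 ≤ K)
    (hK : ∀ l, ‖Torus.partialDeriv l c y‖ ≤ K) :
    ‖Torus.expansionRemainder c Φ y‖ ≤ (2 * Fintype.card d + 1) * K * ∑ l, |Torus.partialDeriv l Φ y| := by
  set S := ∑ l, |Torus.partialDeriv l Φ y| with hS
  have hS0 : 0 ≤ S := Finset.sum_nonneg fun _ _ => abs_nonneg _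
  have hc1 : Torus.IsContDiff 1 c := hc.isContDiff (by simp)
  have hgrad : ‖Torus.gradient Φ y‖ ≤ S :=
    (norm_le_sum_abs'' _).trans (le_of_eq (Finset.sum_congr rfl fun l _ => by rw [Torus.gradient_apply hΦ]))
  -- `|div c| ≤ d K`
  have hdiv : |Torus.divergence c y| ≤ Fintype.card d * K := by
    unfold Torus.divergence
    calc |∑ i, Torus.partialDeriv i (fun z => c z i) y| ≤ ∑ i, |Torus.partialDeriv i (fun z => c z i) y| :=
          Finset.abs_sum_le_sum_abs _ _
      _ ≤ ∑ _i : d, K := Finset.sum_le_sum fun i _ => by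
          rw [Torus.partialDeriv_apply_coord hc1]; exact (Torus.abs_apply_le_norm _ i).trans (hK i)
      _ = Fintype.card d * K := by rw [Finset.sum_const, Finset.card_univ, nsmul_eq_mul]
  -- `‖∇cⱼ‖ ≤ d K`
  have hgc : ∀ j, ‖Torus.gradient (fun z => c z j) y‖ ≤ Fintype.card d * K := by
    intro j
    have hcj : Torus.IsContDiff 1 (fun z => c z j) := (hc.apply j).isContDiff (by simp)
    calc ‖Torus.gradient (fun z => c z j) y‖ ≤ ∑ l, |Torus.gradient (fun z => c z j) y l| := norm_le_sum_abs'' _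
      _ ≤ ∑ _l : d, K := Finset.sum_le_sum fun l _ => by
          rw [Torus.gradient_apply hcj, Torus.partialDeriv_apply_coord hc1]
          exact (Torus.abs_apply_le_norm _ j).trans (hK l)
      _ = Fintype.card d * K := by rw [Finset.sum_const, Finset.card_univ, nsmul_eq_mul]
  unfold Torus.expansionRemainder
  have t1 : ‖∑ j, Torus.partialDeriv j Φ y • Torus.partialDeriv j c y‖ ≤ K * S := by
    refine (norm_sum_le _ _).trans ?_
    rw [hS, Finset.mul_sum]
    refine Finset.sum_le_sum fun j _ => ?_
    rw [norm_smul, Real.norm_eq_abs, mul_comm]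
    exact mul_le_mul_of_nonneg_right (hK j) (abs_nonneg _)
  have t2 : ‖Torus.divergence c y • Torus.gradient Φ y‖ ≤ Fintype.card d * K * S := by
    rw [norm_smul, Real.norm_eq_abs]; exact mul_le_mul hdiv hgrad (norm_nonneg _) (by positivity)
  have t3 : ‖∑ j, Torus.gradient Φ y j • Torus.gradient (fun z => c z j) y‖ ≤ Fintype.card d * K * S := by
    refine (norm_sum_le _ _).trans ?_
    calc ∑ j, ‖Torus.gradient Φ y j • Torus.gradient (fun z => c z j) y‖
        ≤ ∑ j, |Torus.partialDeriv j Φ y| * (Fintype.card d * K) := Finset.sum_le_sum fun j _ => by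
          rw [norm_smul, Real.norm_eq_abs, Torus.gradient_apply hΦ]
          exact mul_le_mul_of_nonneg_left (hgc j) (abs_nonneg _)
      _ = Fintype.card d * K * S := by rw [hS, ← Finset.sum_mul]; ring
  calc ‖∑ j, Torus.partialDeriv j Φ y • Torus.partialDeriv j c y + Torus.divergence c y • Torus.gradient Φ y -
        ∑ j, Torus.gradient Φ y j • Torus.gradient (fun z => c z j) y‖
      ≤ K * S + Fintype.card d * K * S + Fintype.card d * K * S :=
        (norm_sub_le _ _).trans (add_le_add ((norm_add_le _ _).trans (add_le_add t1 t2)) t3)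
    _ = (2 * Fintype.card d + 1) * K * S := by ring

end Expansion

namespace Datum

variable {D : Datum d} (h : D.Valid) {A C : ℝ} (hA : D.DataBounds A) (hC : D.BlockConsts C)

/-! ## The coefficients of the atoms -/

section Atoms

include hA in
/-- `‖c^A_x(t,y)‖ ≤ 3A|G_x'(t)|` on `[0,T]`. [folklore] -/
theorem norm_cA_le (x : Index d) {t : ℝ} (ht : t ∈ Icc 0 D.T) (y : UnitAddTorus d) : ‖D.cA x t y‖ ≤ 3 * A * |D.dG x t| := by
  unfold Datum.cA
  rw [norm_smul, Real.norm_eq_abs, abs_mul]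
  calc |D.dG x t| * |D.atil x t y| * ‖dirVec x‖ ≤ |D.dG x t| * A * 3 := by
        gcongr
        · exact mul_nonneg (abs_nonneg _) hA.nonneg
        · exact hA.atil_le x t ht y
        · exact norm_dirVec_le x
    _ = 3 * A * |D.dG x t| := by ring

include hA in
/-- `‖c^B_{x,j}(t,y)‖ ≤ 2A|G_x'(t)|` on `[0,T]`. [folklore] -/
theorem norm_cB_le (x : Index d) {t : ℝ} (ht : t ∈ Icc 0 D.T) (j : d) (y : UnitAddTorus d) :
    ‖D.cB x t j y‖ ≤ 2 * A * |D.dG x t| := by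
  unfold Datum.cB
  rw [norm_smul, Real.norm_eq_abs, PiLp.norm_single, norm_one, mul_one, abs_mul, abs_mul]
  have := hA.dirD_atil_le x t ht y
  calc |(-2)| * |D.dG x t| * |dirD x (D.atil x t) y| ≤ 2 * |D.dG x t| * A := by
        rw [abs_neg, abs_two]; gcongr
    _ = 2 * A * |D.dG x t| := by ring

include hA in
/-- `‖c^C_x(t,y)‖ ≤ 3A G_x(t)²` on `[0,T]`. [folklore] -/
theorem norm_cC_le (x : Index d) {t : ℝ} (ht : t ∈ Icc 0 D.T) (y : UnitAddTorus d) : ‖D.cC x t y‖ ≤ 3 * A * D.G x t ^ 2 := by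
  unfold Datum.cC
  rw [norm_smul, Real.norm_eq_abs, abs_mul, abs_of_nonneg (sq_nonneg (D.G x t))]
  calc D.G x t ^ 2 * |dirD x (fun z => D.atil x t z ^ 2) y| * ‖dirVec x‖ ≤ D.G x t ^ 2 * A * 3 := by
        gcongr
        · exact mul_nonneg (sq_nonneg _) hA.nonneg
        · exact hA.dirD_atilSq_le x t ht y
        · exact norm_dirVec_le x
    _ = 3 * A * D.G x t ^ 2 := by ring

include h hA in
/-- `‖∂ₗc^B_{x,j}(t,y)‖ ≤ 2A|G_x'(t)|` on `[0,T]`. [folklore] -/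
theorem norm_partialDeriv_cB_le (x : Index d) {t : ℝ} (ht : t ∈ Icc 0 D.T) (j l : d) (y : UnitAddTorus d) :
    ‖Torus.partialDeriv l (D.cB x t j) y‖ ≤ 2 * A * |D.dG x t| := by
  have hdir : Torus.IsContDiff 1 (fun z => dirD x (D.atil x t) z) :=
    ((smooth_dirD h x (smooth_atil h x)).isSmooth_slice ht).isContDiff (by simp)
  have hsc : Torus.IsContDiff 1 (fun z => -2 * D.dG x t * dirD x (D.atil x t) z) := (Torus.isSmooth_const _ |>.isContDiff (by simp)).mul hdir
  have e : D.cB x t j = fun z => (-2 * D.dG x t * dirD x (D.atil x t) z) • EuclideanSpace.single j (1 : ℝ) := rfl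
  rw [e, Torus.partialDeriv_smul hsc ((Torus.isSmooth_const _).isContDiff (by simp)), Torus.partialDeriv_const_apply, smul_zero,
    zero_add, Torus.partialDeriv_const_mul_apply hdir, norm_smul, PiLp.norm_single, norm_one, mul_one, Real.norm_eq_abs, abs_mul,
    abs_mul, abs_neg, abs_two]
  have := hA.d_dirD_atil_le x l t ht y
  calc 2 * |D.dG x t| * |Torus.partialDeriv l (fun z => dirD x (D.atil x t) z) y| ≤ 2 * |D.dG x t| * A := by gcongr
    _ = 2 * A * |D.dG x t| := by ring

include h hA in
/-- `‖∂ₗc^C_x(t,y)‖ ≤ 3A G_x(t)²` on `[0,T]`. [folklore] -/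
theorem norm_partialDeriv_cC_le (x : Index d) {t : ℝ} (ht : t ∈ Icc 0 D.T) (l : d) (y : UnitAddTorus d) :
    ‖Torus.partialDeriv l (D.cC x t) y‖ ≤ 3 * A * D.G x t ^ 2 := by
  have hdir : Torus.IsContDiff 1 (fun z => dirD x (fun w => D.atil x t w ^ 2) z) :=
    ((smooth_dirD h x (smooth_atilSq h x)).isSmooth_slice ht).isContDiff (by simp)
  have hsc : Torus.IsContDiff 1 (fun z => D.G x t ^ 2 * dirD x (fun w => D.atil x t w ^ 2) z) :=
    (Torus.isSmooth_const _ |>.isContDiff (by simp)).mul hdir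
  have e : D.cC x t = fun z => (D.G x t ^ 2 * dirD x (fun w => D.atil x t w ^ 2) z) • dirVec x := rfl
  rw [e, Torus.partialDeriv_smul hsc ((Torus.isSmooth_const _).isContDiff (by simp)), Torus.partialDeriv_const_apply, smul_zero,
    zero_add, Torus.partialDeriv_const_mul_apply hdir, norm_smul, Real.norm_eq_abs, abs_mul, abs_of_nonneg (sq_nonneg (D.G x t))]
  calc D.G x t ^ 2 * |Torus.partialDeriv l (fun z => dirD x (fun w => D.atil x t w ^ 2) z) y| * ‖dirVec x‖
      ≤ D.G x t ^ 2 * A * 3 := by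
        gcongr
        · exact mul_nonneg (sq_nonneg _) hA.nonneg
        · exact hA.d_dirD_atilSq_le x l t ht y
        · exact norm_dirVec_le x
    _ = 3 * A * D.G x t ^ 2 := by ring

end Atoms

/-! ## The pieces of `S₁` -/

section SOne

/-- The expansion tensors of atom `A`, summed over the directions. [folklore] -/
def EA (D : Datum d) (t : ℝ) : UnitAddTorus d → d → EuclideanSpace ℝ d :=
  fun y j => ∑ x, Torus.expansionTensor (D.cA x t) (D.P x) y j

/-- The expansion tensors of the atoms `B`, summed. [folklore] -/
def EB (D : Datum d) (t : ℝ) : UnitAddTorus d → d → EuclideanSpace ℝ d :=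
  fun y j => ∑ x, ∑ j', Torus.expansionTensor (D.cB x t j') (D.ΦB x j') y j

/-- The expansion tensors of atom `C`, summed. [folklore] -/
def EC (D : Datum d) (t : ℝ) : UnitAddTorus d → d → EuclideanSpace ℝ d :=
  fun y j => ∑ x, Torus.expansionTensor (D.cC x t) (D.ΦC x) y j

/-- The quadratic corrector tensor `w ⊗ w - w^{(p)} ⊗ w^{(p)}` (by columns). [cite: CheskidovLuo2022, §4.5 (4.25)] -/
def Qten (D : Datum d) (t : ℝ) : UnitAddTorus d → d → EuclideanSpace ℝ d :=
  fun y j => Torus.tensorProd (D.w t) (D.w t) y j - Torus.tensorProd (D.wp t) (D.wp t) y j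

/-- **`S₁ = (w ⊗ w - w^{(p)} ⊗ w^{(p)}) + E^A + E^B + E^C`**. [cite: CheskidovLuo2022, §4.5 Lemma 4.5] -/
theorem S₁_eq (t : ℝ) : D.S₁ t = fun y j => D.Qten t y j + D.EA t y j + D.EB t y j + D.EC t y j := by
  funext y j
  simp only [Datum.S₁, Qten, EA, EB, EC, Datum.Sexp, Finset.sum_add_distrib]
  abel

/-- **`‖(w ⊗ w - w^{(p)} ⊗ w^{(p)})(t,y)‖ ≤ 2‖w^{(p)}‖‖v‖ + ‖v‖²`**, `v = w^{(c)} + w^{(t)}` (the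
correction tensor of CL22 (4.25)). [cite: CheskidovLuo2022, §5.3 Lemma 5.7] -/
theorem norm_Qten_le (t : ℝ) (y : UnitAddTorus d) :
    ‖D.Qten t y‖ ≤ 2 * ‖D.wp t y‖ * ‖D.wc t y + D.wt t y‖ + ‖D.wc t y + D.wt t y‖ ^ 2 := by
  refine (pi_norm_le_iff_of_nonneg (by positivity)).2 fun j => ?_
  set v := D.wc t y + D.wt t y with hv
  have hw : D.w t y = D.wp t y + v := by rw [hv, Datum.w]; abel
  simp only [Qten, Torus.tensorProd]
  rw [hw]
  have e : (D.wp t y + v) j • (D.wp t y + v) - D.wp t y j • D.wp t y = D.wp t y j • v + v j • D.wp t y + v j • v := by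
    simp only [PiLp.add_apply, smul_add, add_smul]; abel
  rw [e]
  have h1 : |D.wp t y j| ≤ ‖D.wp t y‖ := Torus.abs_apply_le_norm _ j
  have h2 : |v j| ≤ ‖v‖ := Torus.abs_apply_le_norm _ j
  calc ‖D.wp t y j • v + v j • D.wp t y + v j • v‖ ≤ ‖D.wp t y j • v‖ + ‖v j • D.wp t y‖ + ‖v j • v‖ := norm_add₃_le
    _ = |D.wp t y j| * ‖v‖ + |v j| * ‖D.wp t y‖ + |v j| * ‖v‖ := by simp only [norm_smul, Real.norm_eq_abs]
    _ ≤ ‖D.wp t y‖ * ‖v‖ + ‖v‖ * ‖D.wp t y‖ + ‖v‖ * ‖v‖ := by gcongr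
    _ = 2 * ‖D.wp t y‖ * ‖v‖ + ‖v‖ ^ 2 := by ring

include h hA in
/-- `‖E^A(t,y)‖ ≤ ∑_x 6A|G_x'(t)| ∑ₗ|∂ₗP_x(y)|` on `[0,T]`. [cite: CheskidovLuo2022, Lemma 5.6] -/
theorem norm_EA_le {t : ℝ} (ht : t ∈ Icc 0 D.T) (y : UnitAddTorus d) :
    ‖D.EA t y‖ ≤ ∑ x, (6 * A * |D.dG x t|) * |(∑ l, |Torus.partialDeriv l (D.P x) y|)| := by
  refine (pi_norm_le_iff_of_nonneg (Finset.sum_nonneg fun x _ => by have := hA.nonneg; positivity)).2 fun j => ?_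
  simp only [EA]
  refine (norm_sum_le _ _).trans (Finset.sum_le_sum fun x _ => ?_)
  rw [abs_of_nonneg (Finset.sum_nonneg fun l _ => abs_nonneg (Torus.partialDeriv l (D.P x) y))]
  have hP1 : Torus.IsContDiff 1 (D.P x) := (isSmooth_P h x).isContDiff (by simp)
  calc ‖Torus.expansionTensor (D.cA x t) (D.P x) y j‖ ≤ 2 * ‖D.cA x t y‖ * ∑ l, |Torus.partialDeriv l (D.P x) y| :=
        norm_expansionTensor_apply_le hP1 y j
    _ ≤ 2 * (3 * A * |D.dG x t|) * ∑ l, |Torus.partialDeriv l (D.P x) y| :=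
        mul_le_mul_of_nonneg_right (mul_le_mul_of_nonneg_left (norm_cA_le hA x ht y) (by norm_num))
          (Finset.sum_nonneg fun _ _ => abs_nonneg _)
    _ = 6 * A * |D.dG x t| * ∑ l, |Torus.partialDeriv l (D.P x) y| := by ring

include h hA in
/-- `‖E^B(t,y)‖ ≤ ∑_{x,j} 4A|G_x'(t)| ∑ₗ|∂ₗΦ^B_{x,j}(y)|` on `[0,T]`. [cite: CheskidovLuo2022, Lemma 5.6] -/
theorem norm_EB_le {t : ℝ} (ht : t ∈ Icc 0 D.T) (y : UnitAddTorus d) :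
    ‖D.EB t y‖ ≤ ∑ q : Index d × d, (4 * A * |D.dG q.1 t|) * |(∑ l, |Torus.partialDeriv l (D.ΦB q.1 q.2) y|)| := by
  refine (pi_norm_le_iff_of_nonneg (Finset.sum_nonneg fun q _ => by have := hA.nonneg; positivity)).2 fun j => ?_
  simp only [EB]
  rw [← Finset.sum_product' (f := fun x j' => Torus.expansionTensor (D.cB x t j') (D.ΦB x j') y j), Finset.univ_product_univ]
  refine (norm_sum_le _ _).trans (Finset.sum_le_sum fun q _ => ?_)
  rw [abs_of_nonneg (Finset.sum_nonneg fun l _ => abs_nonneg (Torus.partialDeriv l (D.ΦB q.1 q.2) y))]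
  have hΦ1 : Torus.IsContDiff 1 (D.ΦB q.1 q.2) := (isSmooth_ΦB h q.1 q.2).isContDiff (by simp)
  calc ‖Torus.expansionTensor (D.cB q.1 t q.2) (D.ΦB q.1 q.2) y j‖
      ≤ 2 * ‖D.cB q.1 t q.2 y‖ * ∑ l, |Torus.partialDeriv l (D.ΦB q.1 q.2) y| := norm_expansionTensor_apply_le hΦ1 y j
    _ ≤ 2 * (2 * A * |D.dG q.1 t|) * ∑ l, |Torus.partialDeriv l (D.ΦB q.1 q.2) y| :=
        mul_le_mul_of_nonneg_right (mul_le_mul_of_nonneg_left (norm_cB_le hA q.1 ht q.2 y) (by norm_num))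
          (Finset.sum_nonneg fun _ _ => abs_nonneg _)
    _ = 4 * A * |D.dG q.1 t| * ∑ l, |Torus.partialDeriv l (D.ΦB q.1 q.2) y| := by ring

include h hA in
/-- `‖E^C(t,y)‖ ≤ ∑_x 6A G_x(t)² ∑ₗ|∂ₗΦ^C_x(y)|` on `[0,T]`. [cite: CheskidovLuo2022, Lemma 5.8] -/
theorem norm_EC_le {t : ℝ} (ht : t ∈ Icc 0 D.T) (y : UnitAddTorus d) :
    ‖D.EC t y‖ ≤ ∑ x, (6 * A * D.G x t ^ 2) * |(∑ l, |Torus.partialDeriv l (D.ΦC x) y|)| := by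
  refine (pi_norm_le_iff_of_nonneg (Finset.sum_nonneg fun x _ => by have := hA.nonneg; positivity)).2 fun j => ?_
  simp only [EC]
  refine (norm_sum_le _ _).trans (Finset.sum_le_sum fun x _ => ?_)
  rw [abs_of_nonneg (Finset.sum_nonneg fun l _ => abs_nonneg (Torus.partialDeriv l (D.ΦC x) y))]
  have hΦ1 : Torus.IsContDiff 1 (D.ΦC x) := (isSmooth_ΦC h x).isContDiff (by simp)
  calc ‖Torus.expansionTensor (D.cC x t) (D.ΦC x) y j‖ ≤ 2 * ‖D.cC x t y‖ * ∑ l, |Torus.partialDeriv l (D.ΦC x) y| :=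
        norm_expansionTensor_apply_le hΦ1 y j
    _ ≤ 2 * (3 * A * D.G x t ^ 2) * ∑ l, |Torus.partialDeriv l (D.ΦC x) y| :=
        mul_le_mul_of_nonneg_right (mul_le_mul_of_nonneg_left (norm_cC_le hA x ht y) (by norm_num))
          (Finset.sum_nonneg fun _ _ => abs_nonneg _)
    _ = 6 * A * D.G x t ^ 2 * ∑ l, |Torus.partialDeriv l (D.ΦC x) y| := by ring

include h in
/-- `E^A(t)` is smooth on `[0,T]`. [folklore] -/
theorem isSmooth_EA {t : ℝ} (ht : t ∈ Icc 0 D.T) : Torus.IsSmooth (D.EA t) :=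
  isSmooth_tensor_finset_sum _ fun x _ => Torus.isSmooth_expansionTensor (isSmooth_cA h ht x) (isSmooth_P h x)

include h in
/-- `E^B(t)` is smooth on `[0,T]`. [folklore] -/
theorem isSmooth_EB {t : ℝ} (ht : t ∈ Icc 0 D.T) : Torus.IsSmooth (D.EB t) :=
  isSmooth_tensor_finset_sum _ fun x _ => isSmooth_tensor_finset_sum _ fun j' _ =>
    Torus.isSmooth_expansionTensor (isSmooth_cB h ht x j') (isSmooth_ΦB h x j')

include h in
/-- `E^C(t)` is smooth on `[0,T]`. [folklore] -/
theorem isSmooth_EC {t : ℝ} (ht : t ∈ Icc 0 D.T) : Torus.IsSmooth (D.EC t) :=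
  isSmooth_tensor_finset_sum _ fun x _ => Torus.isSmooth_expansionTensor (isSmooth_cC h ht x) (isSmooth_ΦC h x)

include h in
/-- `Q(t)` is smooth on `[0,T]`. [folklore] -/
theorem isSmooth_Qten {t : ℝ} (ht : t ∈ Icc 0 D.T) : Torus.IsSmooth (D.Qten t) :=
  (((smooth_w h).isSmooth_slice ht).tensorProd ((smooth_w h).isSmooth_slice ht)).sub
    (((smooth_wp h).isSmooth_slice ht).tensorProd ((smooth_wp h).isSmooth_slice ht))

end SOne

/-! ## Block norms for `Φ^B`, `Φ^C` -/

section Blocks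

include h hC in
/-- `‖∑ₗ|∂ₗΦ^B_{x,j}|‖_{L^r} ≤ d C σ⁻² μ^{a-2-(d-1)/r}` (`1 ≤ r ≤ 2`). [folklore] -/
theorem eLpNorm_sum_abs_dΦB_le (x : Index d) (j : d) {r : ℝ} (hr : 1 ≤ r) (hr2 : r ≤ 2) :
    eLpNorm (fun y => ∑ l, |Torus.partialDeriv l (D.ΦB x j) y|) (ENNReal.ofReal r) volume ≤
      ENNReal.ofReal (Fintype.card d * (C * ((D.σ : ℝ) ^ 2)⁻¹ * D.μ ^ (aexp d - 2 - ((Fintype.card d : ℝ) - 1) / r))) := by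
  have hr1 : (1 : ℝ≥0∞) ≤ ENNReal.ofReal r := by rw [← ENNReal.ofReal_one]; exact ENNReal.ofReal_le_ofReal hr
  have hμ0 : 0 ≤ D.μ := by linarith [h.hμ]
  have hK0 : 0 ≤ C * ((D.σ : ℝ) ^ 2)⁻¹ * D.μ ^ (aexp d - 2 - ((Fintype.card d : ℝ) - 1) / r) :=
    mul_nonneg (mul_nonneg hC.nonneg (by positivity)) (Real.rpow_nonneg hμ0 _)
  have hmeas : ∀ l, AEStronglyMeasurable (Torus.partialDeriv l (D.ΦB x j)) volume := fun l =>
    ((isSmooth_ΦB h x j).partialDeriv l).continuous.aestronglyMeasurable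
  have h1 := Torus.eLpNorm_le_of_norm_le_sum (E := ℝ) Finset.univ
    (F := fun y => ∑ l, |Torus.partialDeriv l (D.ΦB x j) y|) (c := fun _ => (1 : ℝ))
    (K := fun _ => C * ((D.σ : ℝ) ^ 2)⁻¹ * D.μ ^ (aexp d - 2 - ((Fintype.card d : ℝ) - 1) / r))
    (m := fun l => Torus.partialDeriv l (D.ΦB x j)) (fun _ _ => zero_le_one) (fun _ _ => hK0)
    (fun l _ => hmeas l) (fun l _ => hC.dΦB_Lp x j l r hr hr2) (fun y => ?_) hr1
  · simpa [Finset.sum_const, Finset.card_univ] using h1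
  · rw [Real.norm_eq_abs, abs_of_nonneg (Finset.sum_nonneg fun _ _ => abs_nonneg _)]
    exact le_of_eq (Finset.sum_congr rfl fun l _ => (one_mul _).symm)

include h hC in
/-- `‖∑ₗ|∂ₗΦ^C_x|‖_{L²} ≤ d C σ⁻¹ μ^a`. [folklore] -/
theorem eLpNorm_sum_abs_dΦC_le (x : Index d) :
    eLpNorm (fun y => ∑ l, |Torus.partialDeriv l (D.ΦC x) y|) 2 volume ≤
      ENNReal.ofReal (Fintype.card d * (C * (D.σ : ℝ)⁻¹ * D.μ ^ aexp d)) := by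
  have hμ0 : 0 ≤ D.μ := by linarith [h.hμ]
  have hK0 : 0 ≤ C * (D.σ : ℝ)⁻¹ * D.μ ^ aexp d := mul_nonneg (mul_nonneg hC.nonneg (by positivity)) (Real.rpow_nonneg hμ0 _)
  have hmeas : ∀ l, AEStronglyMeasurable (Torus.partialDeriv l (D.ΦC x)) volume := fun l =>
    ((isSmooth_ΦC h x).partialDeriv l).continuous.aestronglyMeasurable
  have h1 := Torus.eLpNorm_le_of_norm_le_sum (E := ℝ) Finset.univ
    (F := fun y => ∑ l, |Torus.partialDeriv l (D.ΦC x) y|) (c := fun _ => (1 : ℝ))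
    (K := fun _ => C * (D.σ : ℝ)⁻¹ * D.μ ^ aexp d) (m := fun l => Torus.partialDeriv l (D.ΦC x))
    (fun _ _ => zero_le_one) (fun _ _ => hK0) (fun l _ => hmeas l) (fun l _ => hC.dΦC_L2 x l) (fun y => ?_) one_le_two
  · simpa [Finset.sum_const, Finset.card_univ] using h1
  · rw [Real.norm_eq_abs, abs_of_nonneg (Finset.sum_nonneg fun _ _ => abs_nonneg _)]
    exact le_of_eq (Finset.sum_congr rfl fun l _ => (one_mul _).symm)

end Blocks

/-! ## Slice bounds of the pieces of `S₁` -/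

section SOneSlices

include h hA hC in
/-- **`‖E^A(t)‖_{L^r} ≤ ∑_x 6AdCσ⁻¹μ^{a-1-(d-1)/r} |G_x'(t)|`** (`1 ≤ r ≤ 2`; the term `L₂` of CL22
Lemma 5.6: "`L₂ ≲ σ⁻¹∑‖∂ₜa_k‖_{L¹L^∞}‖Ω_k‖_r`", here through the explicit potential instead of
`ℛdiv`). [cite: CheskidovLuo2022, §5.3 Lemma 5.6] -/
theorem eLpNorm_EA_le {t : ℝ} (ht : t ∈ Icc 0 D.T) {r : ℝ} (hr : 1 ≤ r) (hr2 : r ≤ 2) :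
    eLpNorm (D.EA t) (ENNReal.ofReal r) volume ≤
      ENNReal.ofReal (∑ x, (6 * A * (Fintype.card d * (C * (D.σ : ℝ)⁻¹ * D.μ ^ (aexp d - 1 - ((Fintype.card d : ℝ) - 1) / r)))) *
        |D.dG x t|) := by
  have hr1 : (1 : ℝ≥0∞) ≤ ENNReal.ofReal r := by rw [← ENNReal.ofReal_one]; exact ENNReal.ofReal_le_ofReal hr
  have hμ0 : 0 ≤ D.μ := by linarith [h.hμ]
  have hK0 : 0 ≤ Fintype.card d * (C * (D.σ : ℝ)⁻¹ * D.μ ^ (aexp d - 1 - ((Fintype.card d : ℝ) - 1) / r)) := by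
    have := hC.nonneg; positivity
  have hP := fun x => isSmooth_P h x
  refine (Torus.eLpNorm_le_of_norm_le_sum Finset.univ (F := D.EA t) (c := fun x => 6 * A * |D.dG x t|)
    (K := fun _ => Fintype.card d * (C * (D.σ : ℝ)⁻¹ * D.μ ^ (aexp d - 1 - ((Fintype.card d : ℝ) - 1) / r)))
    (m := fun x y => ∑ l, |Torus.partialDeriv l (D.P x) y|)
    (fun x _ => by have := hA.nonneg; positivity) (fun _ _ => hK0)
    (fun x _ => (continuous_finsetSum _ fun l _ => ((hP x).partialDeriv l).continuous.abs).aestronglyMeasurable)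
    (fun x _ => eLpNorm_sum_abs_dP_le h hC x hr hr2) (norm_EA_le h hA ht) hr1).trans (le_of_eq ?_)
  congr 1
  exact Finset.sum_congr rfl fun x _ => by ring

include h hA hC in
/-- **`‖E^B(t)‖_{L^r} ≤ ∑_x 4Ad²Cσ⁻²μ^{a-2-(d-1)/r} |G_x'(t)|`** (`1 ≤ r ≤ 2`; the second-layer part of
`L₂`, one factor `σ⁻¹μ⁻¹` better). [cite: CheskidovLuo2022, §5.3 Lemma 5.6] -/
theorem eLpNorm_EB_le {t : ℝ} (ht : t ∈ Icc 0 D.T) {r : ℝ} (hr : 1 ≤ r) (hr2 : r ≤ 2) :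
    eLpNorm (D.EB t) (ENNReal.ofReal r) volume ≤
      ENNReal.ofReal (∑ x, (4 * A * Fintype.card d *
        (Fintype.card d * (C * ((D.σ : ℝ) ^ 2)⁻¹ * D.μ ^ (aexp d - 2 - ((Fintype.card d : ℝ) - 1) / r)))) * |D.dG x t|) := by
  have hr1 : (1 : ℝ≥0∞) ≤ ENNReal.ofReal r := by rw [← ENNReal.ofReal_one]; exact ENNReal.ofReal_le_ofReal hr
  have hμ0 : 0 ≤ D.μ := by linarith [h.hμ]
  set K : ℝ := Fintype.card d * (C * ((D.σ : ℝ) ^ 2)⁻¹ * D.μ ^ (aexp d - 2 - ((Fintype.card d : ℝ) - 1) / r)) with hK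
  have hK0 : 0 ≤ K := by have := hC.nonneg; positivity
  have hΦ := fun x j => isSmooth_ΦB h x j
  refine (Torus.eLpNorm_le_of_norm_le_sum (Finset.univ : Finset (Index d × d)) (F := D.EB t)
    (c := fun q => 4 * A * |D.dG q.1 t|) (K := fun _ => K)
    (m := fun q y => ∑ l, |Torus.partialDeriv l (D.ΦB q.1 q.2) y|)
    (fun q _ => by have := hA.nonneg; positivity) (fun _ _ => hK0)
    (fun q _ => (continuous_finsetSum _ fun l _ => ((hΦ q.1 q.2).partialDeriv l).continuous.abs).aestronglyMeasurable)
    (fun q _ => eLpNorm_sum_abs_dΦB_le h hC q.1 q.2 hr hr2) (norm_EB_le h hA ht) hr1).trans (le_of_eq ?_)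
  congr 1
  rw [Fintype.sum_prod_type]
  refine Finset.sum_congr rfl fun x _ => ?_
  dsimp only
  rw [Finset.sum_const, Finset.card_univ, nsmul_eq_mul]
  ring

include h hA hC in
/-- **`‖E^C(t)‖_{L^r} ≤ ∑_x 6AdCσ⁻¹μ^a G_x(t)²`** (`1 ≤ r ≤ 2`, through `L²`; the size `σ⁻¹C_u μ^{…}` of
`R_{osc,x}` in CL22 Lemma 5.8, here via the explicit potential `Δ⁻¹(ψ_x² - 1)` instead of `ℬ`).
[cite: CheskidovLuo2022, §5.3 Lemma 5.8] -/
theorem eLpNorm_EC_le {t : ℝ} (ht : t ∈ Icc 0 D.T) {r : ℝ} (hr2 : r ≤ 2) :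
    eLpNorm (D.EC t) (ENNReal.ofReal r) volume ≤
      ENNReal.ofReal (∑ x, (6 * A * (Fintype.card d * (C * (D.σ : ℝ)⁻¹ * D.μ ^ aexp d))) * D.G x t ^ 2) := by
  have hμ0 : 0 ≤ D.μ := by linarith [h.hμ]
  have hK0 : 0 ≤ Fintype.card d * (C * (D.σ : ℝ)⁻¹ * D.μ ^ aexp d) := by have := hC.nonneg; positivity
  have hΦ := fun x => isSmooth_ΦC h x
  have h2 : eLpNorm (D.EC t) 2 volume ≤ ENNReal.ofReal (∑ x, (6 * A * (Fintype.card d * (C * (D.σ : ℝ)⁻¹ * D.μ ^ aexp d))) * D.G x t ^ 2) := by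
    refine (Torus.eLpNorm_le_of_norm_le_sum Finset.univ (F := D.EC t) (c := fun x => 6 * A * D.G x t ^ 2)
      (K := fun _ => Fintype.card d * (C * (D.σ : ℝ)⁻¹ * D.μ ^ aexp d))
      (m := fun x y => ∑ l, |Torus.partialDeriv l (D.ΦC x) y|)
      (fun x _ => by have := hA.nonneg; positivity) (fun _ _ => hK0)
      (fun x _ => (continuous_finsetSum _ fun l _ => ((hΦ x).partialDeriv l).continuous.abs).aestronglyMeasurable)
      (fun x _ => eLpNorm_sum_abs_dΦC_le h hC x) (norm_EC_le h hA ht) one_le_two).trans (le_of_eq ?_)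
    congr 1
    exact Finset.sum_congr rfl fun x _ => by ring
  have hr2' : ENNReal.ofReal r ≤ 2 := by
    have := ENNReal.ofReal_le_ofReal hr2; rwa [ENNReal.ofReal_ofNat] at this
  exact (Torus.eLpNorm_le_eLpNorm_of_le (isSmooth_EC h ht).continuous hr2').trans h2

end SOneSlices

/-! ## The pieces of `ff` and their `L²` slice bounds -/

section FF

/-- `F¹ = ∑_x G_x ∂ₜã_x ψ_x(σ·) k_x`. [folklore] -/
def F1 (D : Datum d) (t : ℝ) (y : UnitAddTorus d) : EuclideanSpace ℝ d :=
  ∑ x, (D.G x t * Torus.timeDerivWithin (Icc 0 D.T) (D.atil x) t y * D.Ψ x y) • dirVec x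

/-- `F² = ∑_x G_x Ω̃_x[∂ₜ∇ã_x]`. [folklore] -/
def F2 (D : Datum d) (t : ℝ) (y : UnitAddTorus d) : EuclideanSpace ℝ d :=
  ∑ x, D.G x t • D.omegaApply x y (Torus.timeDerivWithin (Icc 0 D.T) (D.gradA x) t y)

/-- `F³ = ∑_x (H_xθ² ∂ₜZ_x + H_x(θ²)' Z_x)`. [folklore] -/
def F3 (D : Datum d) (t : ℝ) (y : UnitAddTorus d) : EuclideanSpace ℝ d :=
  ∑ x, ((D.H x t * D.θ t ^ 2) • Torus.timeDerivWithin (Icc 0 D.T) (D.Z x) t y + (D.H x t * deriv (fun s => D.θ s ^ 2) t) • D.Z x t y)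

/-- `F⁴ᴮ = ∑_x ∑ⱼ r(c^B_{x,j}, Φ^B_{x,j})`. [folklore] -/
def F4B (D : Datum d) (t : ℝ) (y : UnitAddTorus d) : EuclideanSpace ℝ d :=
  ∑ x, ∑ j', Torus.expansionRemainder (D.cB x t j') (D.ΦB x j') y

/-- `F⁴ᶜ = ∑_x r(c^C_x, Φ^C_x)`. [folklore] -/
def F4C (D : Datum d) (t : ℝ) (y : UnitAddTorus d) : EuclideanSpace ℝ d :=
  ∑ x, Torus.expansionRemainder (D.cC x t) (D.ΦC x) y

/-- **`ff = F¹ + F² - F³ - F⁴ᴮ - F⁴ᶜ`**. [cite: CheskidovLuo2022, §4.5 Lemma 4.5] -/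
theorem ff_eq (t : ℝ) : D.ff t = fun y => D.F1 t y + D.F2 t y - D.F3 t y - D.F4B t y - D.F4C t y := by
  funext y
  simp only [Datum.ff, F1, F2, F3, F4B, F4C, Datum.rexp, Finset.sum_add_distrib]
  abel

include hA in
/-- `‖F¹(t,y)‖ ≤ ∑_x 3A|G_x(t)| |ψ_x(σy)|` on `[0,T]`. [folklore] -/
theorem norm_F1_le {t : ℝ} (ht : t ∈ Icc 0 D.T) (y : UnitAddTorus d) :
    ‖D.F1 t y‖ ≤ ∑ x, (3 * A * |D.G x t|) * |D.Ψ x y| := by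
  unfold F1
  refine (norm_sum_le _ _).trans (Finset.sum_le_sum fun x _ => ?_)
  rw [norm_smul, Real.norm_eq_abs, abs_mul, abs_mul]
  have h1 := hA.dtatil_le x t ht y
  have h2 := norm_dirVec_le x
  calc |D.G x t| * |Torus.timeDerivWithin (Icc 0 D.T) (D.atil x) t y| * |D.Ψ x y| * ‖dirVec x‖
      ≤ |D.G x t| * A * |D.Ψ x y| * 3 := by
        gcongr
        · exact mul_nonneg (mul_nonneg (abs_nonneg _) hA.nonneg) (abs_nonneg _)
    _ = 3 * A * |D.G x t| * |D.Ψ x y| := by ring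

include h hA in
/-- `‖F²(t,y)‖ ≤ ∑_x 6A|G_x(t)| ∑ₗ|∂ₗP_x(y)|` on `[0,T]`. [folklore] -/
theorem norm_F2_le {t : ℝ} (ht : t ∈ Icc 0 D.T) (y : UnitAddTorus d) :
    ‖D.F2 t y‖ ≤ ∑ x, (6 * A * |D.G x t|) * |(∑ l, |Torus.partialDeriv l (D.P x) y|)| := by
  unfold F2
  refine (norm_sum_le _ _).trans (Finset.sum_le_sum fun x _ => ?_)
  have hS0 : 0 ≤ ∑ l, |Torus.partialDeriv l (D.P x) y| := Finset.sum_nonneg fun _ _ => abs_nonneg _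
  rw [abs_of_nonneg hS0, norm_smul, Real.norm_eq_abs]
  have h1 := norm_omegaApply_le h x y (Torus.timeDerivWithin (Icc 0 D.T) (D.gradA x) t y)
  have h2 := hA.dtgradA_le x t ht y
  have h3 := norm_dirVec_le x
  calc |D.G x t| * ‖D.omegaApply x y (Torus.timeDerivWithin (Icc 0 D.T) (D.gradA x) t y)‖
      ≤ |D.G x t| * (2 * ‖dirVec x‖ * ‖Torus.timeDerivWithin (Icc 0 D.T) (D.gradA x) t y‖ * ∑ l, |Torus.partialDeriv l (D.P x) y|) :=
        mul_le_mul_of_nonneg_left h1 (abs_nonneg _)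
    _ ≤ |D.G x t| * (2 * 3 * A * ∑ l, |Torus.partialDeriv l (D.P x) y|) := by
        refine mul_le_mul_of_nonneg_left (mul_le_mul_of_nonneg_right ?_ hS0) (abs_nonneg _)
        nlinarith [norm_nonneg (dirVec x), norm_nonneg (Torus.timeDerivWithin (Icc 0 D.T) (D.gradA x) t y), hA.nonneg]
    _ = 6 * A * |D.G x t| * ∑ l, |Torus.partialDeriv l (D.P x) y| := by ring

include h hA in
/-- `‖F³(t,y)‖ ≤ N ν⁻¹ (A + 2A²)` on `[0,T]` (`|H_x| ≤ ν⁻¹`, `θ² ≤ 1`, `|(θ²)'| = |2θθ'| ≤ 2A`). [folklore] -/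
theorem norm_F3_le {t : ℝ} (ht : t ∈ Icc 0 D.T) (y : UnitAddTorus d) :
    ‖D.F3 t y‖ ≤ Fintype.card (Index d) * (D.ν⁻¹ * (A + 2 * A ^ 2)) := by
  unfold F3
  refine (norm_sum_le _ _).trans ?_
  have hθ := h.hθ01 t
  have hθ2 : D.θ t ^ 2 ≤ 1 := by nlinarith [hθ.1, hθ.2]
  have hν0 : 0 ≤ D.ν⁻¹ := inv_nonneg.2 (by linarith [h.hν])
  have hder : deriv (fun s => D.θ s ^ 2) t = (2 : ℕ) * D.θ t ^ (2 - 1) * deriv D.θ t :=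
    (((h.hθ.differentiable (by simp)).differentiableAt (x := t)).hasDerivAt.pow 2).deriv
  have hder' : |deriv (fun s => D.θ s ^ 2) t| ≤ 2 * A := by
    rw [hder]
    simp only [Nat.cast_ofNat, Nat.add_one_sub_one, pow_one, abs_mul, abs_two]
    have h1 : |D.θ t| ≤ 1 := abs_le.2 ⟨by linarith [hθ.1], hθ.2⟩
    have h2 := hA.dθ_le t ht
    calc 2 * |D.θ t| * |deriv D.θ t| ≤ 2 * 1 * A := by gcongr
      _ = 2 * A := by ring
  calc ∑ x, ‖(D.H x t * D.θ t ^ 2) • Torus.timeDerivWithin (Icc 0 D.T) (D.Z x) t y + (D.H x t * deriv (fun s => D.θ s ^ 2) t) • D.Z x t y‖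
      ≤ ∑ _x : Index d, D.ν⁻¹ * (A + 2 * A ^ 2) := Finset.sum_le_sum fun x _ => by
        have hH := abs_H_le h x t
        refine (norm_add_le _ _).trans ?_
        rw [norm_smul, norm_smul, Real.norm_eq_abs, Real.norm_eq_abs, abs_mul, abs_mul, abs_of_nonneg (sq_nonneg (D.θ t))]
        have a1 : |D.H x t| * D.θ t ^ 2 * ‖Torus.timeDerivWithin (Icc 0 D.T) (D.Z x) t y‖ ≤ D.ν⁻¹ * 1 * A :=
          mul_le_mul (mul_le_mul hH hθ2 (sq_nonneg _) hν0) (hA.dtZ_le x t ht y) (norm_nonneg _) (mul_nonneg hν0 zero_le_one)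
        have a2 : |D.H x t| * |deriv (fun s => D.θ s ^ 2) t| * ‖D.Z x t y‖ ≤ D.ν⁻¹ * (2 * A) * A :=
          mul_le_mul (mul_le_mul hH hder' (abs_nonneg _) hν0) (hA.Z_le x t ht y) (norm_nonneg _) (mul_nonneg hν0 (by linarith [hA.nonneg]))
        nlinarith
    _ = Fintype.card (Index d) * (D.ν⁻¹ * (A + 2 * A ^ 2)) := by rw [Finset.sum_const, Finset.card_univ, nsmul_eq_mul]

include h hA in
/-- `‖F⁴ᴮ(t,y)‖ ≤ ∑_{x,j} 2(2d+1)A|G_x'(t)| ∑ₗ|∂ₗΦ^B_{x,j}(y)|` on `[0,T]`. [folklore] -/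
theorem norm_F4B_le {t : ℝ} (ht : t ∈ Icc 0 D.T) (y : UnitAddTorus d) :
    ‖D.F4B t y‖ ≤ ∑ q : Index d × d, ((2 * Fintype.card d + 1) * (2 * A * |D.dG q.1 t|)) *
      |(∑ l, |Torus.partialDeriv l (D.ΦB q.1 q.2) y|)| := by
  unfold F4B
  rw [← Finset.sum_product' (f := fun x j' => Torus.expansionRemainder (D.cB x t j') (D.ΦB x j') y), Finset.univ_product_univ]
  refine (norm_sum_le _ _).trans (Finset.sum_le_sum fun q _ => ?_)
  rw [abs_of_nonneg (Finset.sum_nonneg fun l _ => abs_nonneg (Torus.partialDeriv l (D.ΦB q.1 q.2) y))]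
  exact norm_expansionRemainder_le (isSmooth_cB h ht q.1 q.2) ((isSmooth_ΦB h q.1 q.2).isContDiff (by simp)) y
    (by have := hA.nonneg; positivity) fun l => norm_partialDeriv_cB_le h hA q.1 ht q.2 l y

include h hA in
/-- `‖F⁴ᶜ(t,y)‖ ≤ ∑_x 3(2d+1)A G_x(t)² ∑ₗ|∂ₗΦ^C_x(y)|` on `[0,T]`. [folklore] -/
theorem norm_F4C_le {t : ℝ} (ht : t ∈ Icc 0 D.T) (y : UnitAddTorus d) :
    ‖D.F4C t y‖ ≤ ∑ x, ((2 * Fintype.card d + 1) * (3 * A * D.G x t ^ 2)) * |(∑ l, |Torus.partialDeriv l (D.ΦC x) y|)| := by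
  unfold F4C
  refine (norm_sum_le _ _).trans (Finset.sum_le_sum fun x _ => ?_)
  rw [abs_of_nonneg (Finset.sum_nonneg fun l _ => abs_nonneg (Torus.partialDeriv l (D.ΦC x) y))]
  exact norm_expansionRemainder_le (isSmooth_cC h ht x) ((isSmooth_ΦC h x).isContDiff (by simp)) y
    (by have := hA.nonneg; positivity) fun l => norm_partialDeriv_cC_le h hA x ht l y

include h hA hC in
/-- **`‖F¹(t)‖_{L²} ≤ ∑_x 3AC |G_x(t)|`** (`‖ψ_x‖₂ ≲ 1`). [cite: CheskidovLuo2022, §5.3 Lemma 5.6] -/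
theorem eLpNorm_F1_le {t : ℝ} (ht : t ∈ Icc 0 D.T) :
    eLpNorm (D.F1 t) 2 volume ≤ ENNReal.ofReal (∑ x, (3 * A * C) * |D.G x t|) := by
  have hμ := h.hμ
  have hμ0 : 0 ≤ D.μ := by linarith
  have hΨ2 : ∀ x, eLpNorm (D.Ψ x) 2 volume ≤ ENNReal.ofReal C := by
    intro x
    have h1 := hC.Ψ_Lp x 2 one_le_two le_rfl
    rw [ENNReal.ofReal_ofNat] at h1
    refine h1.trans (ENNReal.ofReal_le_ofReal ?_)
    have : aexp d - ((Fintype.card d : ℝ) - 1) / 2 = 0 := by rw [aexp]; ring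
    rw [this, Real.rpow_zero, mul_one]
  refine (Torus.eLpNorm_le_of_norm_le_sum Finset.univ (F := D.F1 t) (c := fun x => 3 * A * |D.G x t|) (K := fun _ => C)
    (m := fun x => D.Ψ x) (fun x _ => by have := hA.nonneg; positivity) (fun _ _ => hC.nonneg)
    (fun x _ => (isSmooth_Ψ h x).continuous.aestronglyMeasurable) (fun x _ => hΨ2 x) (norm_F1_le hA ht) one_le_two).trans
    (le_of_eq ?_)
  congr 1
  exact Finset.sum_congr rfl fun x _ => by ring

include h hA hC in
/-- **`‖F²(t)‖_{L²} ≤ ∑_x 6AdCσ⁻¹μ⁻¹ |G_x(t)|`**. [cite: CheskidovLuo2022, §5.3 Lemma 5.6] -/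
theorem eLpNorm_F2_le {t : ℝ} (ht : t ∈ Icc 0 D.T) :
    eLpNorm (D.F2 t) 2 volume ≤ ENNReal.ofReal (∑ x, (6 * A * (Fintype.card d * (C * (D.σ : ℝ)⁻¹ * D.μ ^ (-1 : ℝ)))) * |D.G x t|) := by
  have hμ0 : 0 ≤ D.μ := by linarith [h.hμ]
  have hK0 : 0 ≤ Fintype.card d * (C * (D.σ : ℝ)⁻¹ * D.μ ^ (-1 : ℝ)) := by have := hC.nonneg; positivity
  have hP := fun x => isSmooth_P h x
  have hblock : ∀ x, eLpNorm (fun y => ∑ l, |Torus.partialDeriv l (D.P x) y|) 2 volume ≤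
      ENNReal.ofReal (Fintype.card d * (C * (D.σ : ℝ)⁻¹ * D.μ ^ (-1 : ℝ))) := by
    intro x
    have h1 := eLpNorm_sum_abs_dP_le h hC x one_le_two le_rfl
    rw [ENNReal.ofReal_ofNat] at h1
    refine h1.trans (le_of_eq ?_)
    congr 3
    rw [aexp]; ring
  refine (Torus.eLpNorm_le_of_norm_le_sum Finset.univ (F := D.F2 t) (c := fun x => 6 * A * |D.G x t|)
    (K := fun _ => Fintype.card d * (C * (D.σ : ℝ)⁻¹ * D.μ ^ (-1 : ℝ)))
    (m := fun x y => ∑ l, |Torus.partialDeriv l (D.P x) y|) (fun x _ => by have := hA.nonneg; positivity) (fun _ _ => hK0)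
    (fun x _ => (continuous_finsetSum _ fun l _ => ((hP x).partialDeriv l).continuous.abs).aestronglyMeasurable)
    (fun x _ => hblock x) (norm_F2_le h hA ht) one_le_two).trans (le_of_eq ?_)
  congr 1
  exact Finset.sum_congr rfl fun x _ => by ring

include h hA in
/-- **`‖F³(t)‖_{L^p} ≤ N ν⁻¹ (A + 2A²)`** (any `p`). [cite: CheskidovLuo2022, Prop. 5.5] -/
theorem eLpNorm_F3_le {t : ℝ} (ht : t ∈ Icc 0 D.T) (p : ℝ≥0∞) :
    eLpNorm (D.F3 t) p volume ≤ ENNReal.ofReal (Fintype.card (Index d) * (D.ν⁻¹ * (A + 2 * A ^ 2))) :=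
  Torus.eLpNorm_le_of_forall_norm_le (norm_F3_le h hA ht) p

include h hA hC in
/-- **`‖F⁴ᴮ(t)‖_{L²} ≤ ∑_x 2(2d+1)Ad²Cσ⁻²μ⁻² |G_x'(t)|`**. [cite: CheskidovLuo2022, §5.3 Lemma 5.6] -/
theorem eLpNorm_F4B_le {t : ℝ} (ht : t ∈ Icc 0 D.T) :
    eLpNorm (D.F4B t) 2 volume ≤ ENNReal.ofReal (∑ x, ((2 * Fintype.card d + 1) * (2 * A) * Fintype.card d *
      (Fintype.card d * (C * ((D.σ : ℝ) ^ 2)⁻¹ * D.μ ^ (-2 : ℝ)))) * |D.dG x t|) := by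
  have hμ0 : 0 ≤ D.μ := by linarith [h.hμ]
  set K : ℝ := Fintype.card d * (C * ((D.σ : ℝ) ^ 2)⁻¹ * D.μ ^ (-2 : ℝ)) with hK
  have hK0 : 0 ≤ K := by have := hC.nonneg; positivity
  have hΦ := fun x j => isSmooth_ΦB h x j
  have hblock : ∀ x j, eLpNorm (fun y => ∑ l, |Torus.partialDeriv l (D.ΦB x j) y|) 2 volume ≤ ENNReal.ofReal K := by
    intro x j
    have h1 := eLpNorm_sum_abs_dΦB_le h hC x j one_le_two le_rfl
    rw [ENNReal.ofReal_ofNat] at h1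
    refine h1.trans (le_of_eq ?_)
    rw [hK]; congr 4
    rw [aexp]; ring
  refine (Torus.eLpNorm_le_of_norm_le_sum (Finset.univ : Finset (Index d × d)) (F := D.F4B t)
    (c := fun q => (2 * Fintype.card d + 1) * (2 * A * |D.dG q.1 t|)) (K := fun _ => K)
    (m := fun q y => ∑ l, |Torus.partialDeriv l (D.ΦB q.1 q.2) y|)
    (fun q _ => by have := hA.nonneg; positivity) (fun _ _ => hK0)
    (fun q _ => (continuous_finsetSum _ fun l _ => ((hΦ q.1 q.2).partialDeriv l).continuous.abs).aestronglyMeasurable)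
    (fun q _ => hblock q.1 q.2) (norm_F4B_le h hA ht) one_le_two).trans (le_of_eq ?_)
  congr 1
  rw [Fintype.sum_prod_type]
  refine Finset.sum_congr rfl fun x _ => ?_
  dsimp only
  rw [Finset.sum_const, Finset.card_univ, nsmul_eq_mul]
  ring

include h hA hC in
/-- **`‖F⁴ᶜ(t)‖_{L²} ≤ ∑_x 3(2d+1)AdCσ⁻¹μ^a G_x(t)²`**. [cite: CheskidovLuo2022, §5.3 Lemma 5.8] -/
theorem eLpNorm_F4C_le {t : ℝ} (ht : t ∈ Icc 0 D.T) :
    eLpNorm (D.F4C t) 2 volume ≤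
      ENNReal.ofReal (∑ x, ((2 * Fintype.card d + 1) * (3 * A) * (Fintype.card d * (C * (D.σ : ℝ)⁻¹ * D.μ ^ aexp d))) * D.G x t ^ 2) := by
  have hμ0 : 0 ≤ D.μ := by linarith [h.hμ]
  have hK0 : 0 ≤ Fintype.card d * (C * (D.σ : ℝ)⁻¹ * D.μ ^ aexp d) := by have := hC.nonneg; positivity
  have hΦ := fun x => isSmooth_ΦC h x
  refine (Torus.eLpNorm_le_of_norm_le_sum Finset.univ (F := D.F4C t)
    (c := fun x => (2 * Fintype.card d + 1) * (3 * A * D.G x t ^ 2)) (K := fun _ => Fintype.card d * (C * (D.σ : ℝ)⁻¹ * D.μ ^ aexp d))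
    (m := fun x y => ∑ l, |Torus.partialDeriv l (D.ΦC x) y|)
    (fun x _ => by have := hA.nonneg; positivity) (fun _ _ => hK0)
    (fun x _ => (continuous_finsetSum _ fun l _ => ((hΦ x).partialDeriv l).continuous.abs).aestronglyMeasurable)
    (fun x _ => eLpNorm_sum_abs_dΦC_le h hC x) (norm_F4C_le h hA ht) one_le_two).trans (le_of_eq ?_)
  congr 1
  exact Finset.sum_congr rfl fun x _ => by ring

include h in
/-- `F¹(t)` is continuous on `[0,T]`. [folklore] -/
theorem continuous_F1 {t : ℝ} (ht : t ∈ Icc 0 D.T) : Continuous (D.F1 t) := by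
  unfold F1
  refine continuous_finsetSum _ fun x _ => ?_
  exact ((continuous_const.mul (((smooth_atil h x).timeDerivWithin (uniqueDiffOn h)).isSmooth_slice ht).continuous).mul
    (isSmooth_Ψ h x).continuous).smul continuous_const

include h in
/-- `F²(t)` is continuous on `[0,T]`. [folklore] -/
theorem continuous_F2 {t : ℝ} (ht : t ∈ Icc 0 D.T) : Continuous (D.F2 t) := by
  unfold F2
  refine continuous_finsetSum _ fun x _ => ?_
  exact ((smooth_omegaApply h x ((smooth_gradA h x).timeDerivWithin (uniqueDiffOn h))).isSmooth_slice ht).continuous.const_smul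
    (D.G x t)

include h in
/-- `F³(t)` is continuous on `[0,T]`. [folklore] -/
theorem continuous_F3 {t : ℝ} (ht : t ∈ Icc 0 D.T) : Continuous (D.F3 t) := by
  unfold F3
  refine continuous_finsetSum _ fun x _ => ?_
  exact ((((smooth_Z h x).timeDerivWithin (uniqueDiffOn h)).isSmooth_slice ht).continuous.const_smul (D.H x t * D.θ t ^ 2)).add
    ((isSmooth_Z h x ht).continuous.const_smul (D.H x t * deriv (fun s => D.θ s ^ 2) t))

include h in
/-- `F⁴ᴮ(t)` is continuous on `[0,T]`. [folklore] -/
theorem continuous_F4B {t : ℝ} (ht : t ∈ Icc 0 D.T) : Continuous (D.F4B t) := by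
  unfold F4B
  refine continuous_finsetSum _ fun x _ => continuous_finsetSum _ fun j' _ => ?_
  exact (Torus.isSmooth_expansionRemainder (isSmooth_cB h ht x j') (isSmooth_ΦB h x j')).continuous

include h in
/-- `F⁴ᶜ(t)` is continuous on `[0,T]`. [folklore] -/
theorem continuous_F4C {t : ℝ} (ht : t ∈ Icc 0 D.T) : Continuous (D.F4C t) := by
  unfold F4C
  refine continuous_finsetSum _ fun x _ => ?_
  exact (Torus.isSmooth_expansionRemainder (isSmooth_cC h ht x) (isSmooth_ΦC h x)).continuous

end FF

end Datum

end CL22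

end Literature.Analysis.FluidPDE
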